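import Summits.NavierStokesRegularity.NavierStokesRegularity.Theorems.HubbleDynamoNoSelfExcitedDynamoReduction
import Literature.Analysis.FluidPDE.KNSSMildDecayProofs
import Literature.Analysis.FluidPDE.KNSSTypeIRateLiouvilleMild
import HarnessLib

/-!
# Crux `NoSelfExcitedDynamo` (stmt-NavierStokesRegularity-1934), line `registered`: the converse of the
  reduction — the crux IS the eternal Liouville problem in similarity variables

Theorems file (lands `--supports stmt-NavierStokesRegularity-1934`; registered sub-goal
`stub_eternalLiouvilleOfCrux`). Together with `stub_eternalReduction` (file
`HubbleDynamoNoSelfExcitedDynamoReduction.lean`) it records the EQUIVALENCE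

  `NoSelfExcitedDynamo` ⇔ every eternal classical solution `(U, P)` of Leray's backward system
  `∂ₛU + ½U + ½(y·∇)U + (U·∇)U + ∇P = ΔU`, `div U = 0` on `ℝ × ℝ³` in the uniform profile class
  `(1 + ‖y‖)^{k+1}‖DᵏU(s,y)‖ ≤ K_k` which switches off like `‖U(s, y)‖ ≤ M e^{−s/2}` vanishes identically,

so that the one open stub of the line (`stub_amplitudeSqueeze`, the bound `sup ‖U‖ < 1` for such fields)
is seen to be equivalent to the crux itself (given the landed Backus regime).

## Proof of the converse

Given such `(U, P)`, the physical pair `(u, p) = (ofLerayOrbit U, ofLerayOrbitPressure P)` is a classical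
unforced Navier–Stokes solution on `(−∞, 0) × ℝ³` (the tree's dictionary
`isClassicalNSSolutionOn_Iio_ofLerayOrbit_iff`), it has the pointwise Type-I bound with constant `K₀`
(`hasTypeIDecay_iff_lerayOrbit`, `lerayOrbit (ofLerayOrbit U) = U`), and it is BOUNDED by `M`
(`‖u(t, x)‖ = (−t)^{−1/2}‖U(σ, ·)‖ ≤ (−t)^{−1/2} M e^{−σ/2} = M`, `σ = −log(−t)`). A bounded classical
solution with `r‖u‖ ≤ K₀` is Oseen-mild between all pairs of negative times (KNSS 2009, Thm 6.1,
mildness clause: `KNSS2009_mild_of_rMulNorm_bounded_holds`), hence a bounded ancient mild solution in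
the duality form (`isBoundedAncientMildSolution_of_oseen`); its slices are continuous, so measurable.
The crux gives `u(t) = 0` a.e., hence everywhere (continuity), hence `U = lerayOrbit u = 0`.
-/

noncomputable section

-- the mandated stub namespace repeats `NavierStokesRegularity` (tree precedent for this crux's stubs)
set_option linter.dupNamespace false

namespace Summit.NavierStokesRegularity.NavierStokesRegularity.Theorems.NoSelfExcitedDynamo.Registered

open Set MeasureTheory Filter Topology
open scoped ContDiff
open Literature.Analysis.FluidPDE

/-- **The physical field of a switching-off profile is bounded**: if `‖U(s, y)‖ ≤ M e^{−s/2}` for all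
`s, y`, then `‖ofLerayOrbit U (t, x)‖ ≤ M` for all `t < 0`, `x`
(`u(t, x) = (√(−t))⁻¹ U(−log(−t), x/√(−t))` and `e^{log(−t)/2} = √(−t)`). -/
theorem converse_norm_ofLerayOrbit_le {U : ℝ → EuclideanSpace ℝ (Fin 3) → EuclideanSpace ℝ (Fin 3)}
    {M : ℝ} (hM : ∀ s y, ‖U s y‖ ≤ M * Real.exp (-s / 2)) {t : ℝ} (ht : t < 0)
    (x : EuclideanSpace ℝ (Fin 3)) : ‖ofLerayOrbit U t x‖ ≤ M := by
  have hsq : 0 < Real.sqrt (-t) := Real.sqrt_pos.2 (neg_pos.2 ht)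
  have key := hM (-Real.log (-t)) ((Real.sqrt (-t))⁻¹ • x)
  rw [show -(-Real.log (-t)) / 2 = Real.log (-t) / 2 by ring, exp_log_neg_div_two ht] at key
  rw [ofLerayOrbit_apply, norm_smul, norm_inv, Real.norm_of_nonneg hsq.le]
  calc (Real.sqrt (-t))⁻¹ * ‖U (-Real.log (-t)) ((Real.sqrt (-t))⁻¹ • x)‖
      ≤ (Real.sqrt (-t))⁻¹ * (M * Real.sqrt (-t)) :=
        mul_le_mul_of_nonneg_left key (inv_nonneg.2 hsq.le)
    _ = M := by field_simp

/-- **The physical field of an eternal profile-class solution with forward switch-off satisfies the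
crux's hypotheses**: `u = ofLerayOrbit U` is a bounded ancient mild solution in the duality form
(`ν = 1`), has continuous (hence measurable) slices, and has the pointwise Type-I bound with the
`k = 0` profile constant. The mildness is KNSS's Theorem 6.1 (mildness clause,
`KNSS2009_mild_of_rMulNorm_bounded_holds`) applied on the windows `(s − 1, 0) ∋ t` to the classical
bounded solution with `r‖u‖ ≤ K₀`, followed by `isBoundedAncientMildSolution_of_oseen`. -/
theorem converse_hypotheses {U : ℝ → EuclideanSpace ℝ (Fin 3) → EuclideanSpace ℝ (Fin 3)}
    {P : ℝ → EuclideanSpace ℝ (Fin 3) → ℝ} (hL : IsBackwardLeraySolutionOn univ 1 U P)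
    {K₀ : ℝ} (hK₀ : ∀ s y, (1 + ‖y‖) * ‖U s y‖ ≤ K₀)
    {M : ℝ} (hM : ∀ s y, ‖U s y‖ ≤ M * Real.exp (-s / 2)) :
    IsClassicalNSSolutionOn (Iio 0) 1 0 (ofLerayOrbit U) (ofLerayOrbitPressure P) ∧
    IsBoundedAncientMildSolution 1 (ofLerayOrbit U) ∧
    (∀ t < 0, AEStronglyMeasurable (ofLerayOrbit U t) volume) ∧
    HasTypeIDecay K₀ (ofLerayOrbit U) := by
  set u := ofLerayOrbit U with hu_def
  set p := ofLerayOrbitPressure P with hp_def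
  have hcl : IsClassicalNSSolutionOn (Iio 0) 1 0 u p :=
    isClassicalNSSolutionOn_Iio_ofLerayOrbit_iff.2 hL
  -- Type-I decay with the `k = 0` profile constant
  have hdec : HasTypeIDecay K₀ u := by
    refine hasTypeIDecay_iff_lerayOrbit.2 fun s y => ?_
    rw [hu_def, lerayOrbit_ofLerayOrbit_eq]
    exact hK₀ s y
  -- boundedness
  have hbdd : ∀ t < 0, ∀ x, ‖u t x‖ ≤ M := fun t ht x => converse_norm_ofLerayOrbit_le hM ht x
  -- continuity and measurability
  have hcont : ContinuousOn (Function.uncurry u) (Iio 0 ×ˢ univ) := hcl.smooth_velocity.continuousOn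
  have hslice : ∀ t < 0, Continuous (u t) := fun t ht => (hcl.contDiff_velocity ht).continuous
  have hmeas : ∀ t < 0, AEStronglyMeasurable (u t) volume := fun t ht =>
    (hslice t ht).aestronglyMeasurable
  -- weakly divergence-free slices
  have hwdiv : ∀ t < 0, IsWeaklyDivFree (u t) := fun t ht =>
    VectorCalculus.IsDivFree.isWeaklyDivFree_holds (hcl.divFree t ht)
      ((hcl.contDiff_velocity ht).of_le (by norm_cast))
  -- the Oseen identity between all pairs of negative times (KNSS Thm 6.1, mildness clause)
  have hmild : ∀ s t : ℝ, s < t → t < 0 → ∀ x,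
      u t x = Literature.Analysis.UnboundedOperators.heatExtension (u s) (1 * (t - s)) x - oseenDuhamel 1 s u u t x := by
    intro s t hst ht x
    rw [one_mul]
    have hwin : IsClassicalNSSolutionOn (Ioo (s - 1) 0) 1 0 u p :=
      hcl.mono (fun τ hτ => hτ.2) (uniqueDiffOn_Ioo _ _)
    have hL' : ∃ L : ℝ, ∀ τ ∈ Ioc (s - 1) t, ∀ x, ‖u τ x‖ ≤ L :=
      ⟨M, fun τ hτ x => hbdd τ (hτ.2.trans_lt ht) x⟩
    have hD : ∃ D : ℝ, ∀ τ ∈ Ioc (s - 1) t, ∀ x, cylRadius x * ‖u τ x‖ ≤ D :=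
      ⟨K₀, fun τ hτ x => reduction_cylRadius_mul_norm_le hdec τ (hτ.2.trans_lt ht) x⟩
    exact KNSS2009_mild_of_rMulNorm_bounded_holds hwin (by linarith) ht hL' hD (by linarith) hst
      le_rfl x
  have hmildsol : IsBoundedAncientMildSolution 1 u :=
    isBoundedAncientMildSolution_of_oseen one_pos hcont ⟨M, hbdd⟩ hwdiv hmild
  exact ⟨hcl, hmildsol, hmeas, hdec⟩

/-- **The crux implies the eternal Liouville statement** (registered sub-goal
`stub_eternalLiouvilleOfCrux`; converse of `stub_eternalReduction`): IF `NoSelfExcitedDynamo` holds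
(hypothesis written unfolded), THEN every eternal classical solution of Leray's backward system on
`ℝ × ℝ³` in the uniform profile class which switches off like `‖U(s, y)‖ ≤ M e^{−s/2}` vanishes
identically. Hence the line's open stub `stub_amplitudeSqueeze` is, given the landed Backus regime,
EQUIVALENT to the crux. -/
theorem stub_eternalLiouvilleOfCrux :
    (∀ u : ℝ → EuclideanSpace ℝ (Fin 3) → EuclideanSpace ℝ (Fin 3),
      IsBoundedAncientMildSolution 1 u →
      (∀ t < 0, AEStronglyMeasurable (u t) volume) → (∃ C : ℝ, HasTypeIDecay C u) →
      ∀ t < 0, u t =ᵐ[volume] (0 : EuclideanSpace ℝ (Fin 3) → EuclideanSpace ℝ (Fin 3))) →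
    ∀ (U : ℝ → EuclideanSpace ℝ (Fin 3) → EuclideanSpace ℝ (Fin 3)) (P : ℝ → EuclideanSpace ℝ (Fin 3) → ℝ),
      IsBackwardLeraySolutionOn univ 1 U P →
      (∀ k : ℕ, ∃ K : ℝ, ∀ s y, (1 + ‖y‖) ^ (k + 1) * ‖iteratedFDeriv ℝ k (U s) y‖ ≤ K) →
      (∃ M : ℝ, ∀ s y, ‖U s y‖ ≤ M * Real.exp (-s / 2)) →
      ∀ s y, U s y = 0 := by
  intro hcrux U P hL hprof hM s y
  obtain ⟨K₀, hK₀'⟩ := hprof 0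
  have hK₀ : ∀ s y, (1 + ‖y‖) * ‖U s y‖ ≤ K₀ := fun s y => by
    have h := hK₀' s y
    rwa [zero_add, pow_one, norm_iteratedFDeriv_zero] at h
  obtain ⟨M, hM⟩ := hM
  obtain ⟨hcl, hmild, hmeas, hdec⟩ := converse_hypotheses hL hK₀ hM
  -- the crux: every slice of the physical field vanishes a.e., hence everywhere
  have hzero : ∀ t < 0, ofLerayOrbit U t = 0 := by
    intro t ht
    have hae := hcrux (ofLerayOrbit U) hmild hmeas ⟨K₀, hdec⟩ t ht
    exact Measure.eq_of_ae_eq hae (hcl.contDiff_velocity ht).continuous continuous_const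
  -- back to the profile: `U = lerayOrbit (ofLerayOrbit U)`
  have e : U s y = lerayOrbit (ofLerayOrbit U) s y := by rw [lerayOrbit_ofLerayOrbit_eq]
  rw [e, lerayOrbit_apply, hzero _ (neg_exp_neg_lt_zero s)]
  simp

end Summit.NavierStokesRegularity.NavierStokesRegularity.Theorems.NoSelfExcitedDynamo.Registered

end
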